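import Summits.ResolutionOfSingularities.ResolutionOfSingularities.Theorems.WildQuotientsSummitReductionStubPairOrbitNormalFormBlowupModelCharts
import Literature.AlgebraicGeometry.Resolution.HypersurfaceTransformChart
import HarnessLib

/-!
# `WildQuotients.SummitReduction` (stmt-ResolutionOfSingularities-16324), line `FramePerfect`, stub NB1
# (`stub_pair_orbitNormalFormBlowup_modelSingularOverCentre`): the Jacobian step on a blow-up
# chart and the transport to the chart of a hypersurface

Route `ResolutionOfSingularities/WildQuotients`, crux `SummitReduction`; second helper file of
stub NB1 (de Jong 1996, Claim 4.27 [C1] on the coefficient-free model; set-up in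
`…OrbitNormalFormBlowupModelCharts.lean`). Generalities used on all four charts, PROVED for
arbitrary commutative rings:

* `eval_pderiv_mem_of_mul_eval_mem_sq` — **the Jacobian step on a chart `R[I/xᵢ]`**
  (`x` quasi-regular): if `Q ∋ xᵢ` is a prime of the chart ring and `w · p(x/xᵢ) ∈ Q²` with
  `w ∉ Q`, then every `(∂p/∂T_j)(x/xᵢ)` lies in `Q` — Stacks 07PF read contrapositively through
  the presentation `R[T_j : j ≠ i] ↠ R[I/xᵢ]`, whose relations lie in `I · R[T]` (Stacks 0BIQ,
  tree `notMem_sq_maximalIdeal_of_pderiv_notMem`);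
* `eval_notMem_span_of_pderiv_eq_one`, `…_pderiv_pderiv_eq_one` — non-divisibility of
  `p(x/xᵢ)` by the exceptional equation, tested by a derivative equal to `1`;
* `exists_mul_mem_sq_comap_of_surjective`,
  `isRegularLocalRing_localization_of_surjective_of_notMem_sq`,
  `isPrime_map_of_surjective_of_mem` — transport between a ring `C` and `B ≅ C/(f')` along a
  surjection `φ : C ↠ B` with kernel `(f')` (the chart `R[I/a] ↠ (R/(f))[Ī/ā]` of a
  hypersurface, `blowupAlgebra.mapQuotient` with `blowupAlgebra.ker_mapQuotient_eq_span`):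
  a singular prime of `B` gives `w ∉ Q`, `w f' ∈ Q²` upstairs; `f' ∉ 𝔪_Q²` with `C_Q` regular
  gives regularity downstairs (Matsumura 14.2); primes through `f'` push forward;
* `algebraMap_mem_comap_mapQuotient_iff`, `map_mapQuotient_map_algebraMap` — bookkeeping for
  `R[I/a] ↠ (R/(f))[Ī/ā]` on constants and extended ideals.

(The transports are phrased for a surjection rather than for the ring isomorphism
`blowupAlgebra.quotientKerMapQuotientEquiv`, whose type does not unify cheaply with lemmas
stated for a generic quotient `C ⧸ (f')`.)

## Sources

* A. J. de Jong, *Smoothness, semi-stability and alterations*, Publ. Math. IHÉS 83 (1996), 4.27,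
  pp. 75–76. [DeJong1996]
* H. Matsumura, *Commutative Ring Theory* (1986), Thm. 14.2. [Matsumura1987]
* The Stacks Project, Tags 07PF, 0BIQ, 07Z3. [StacksProject]
* U. Görtz, T. Wedhorn, *Algebraic Geometry I*, 2nd ed. (2020), Prop. 13.96 (2), p. 416.
  [GortzWedhorn2020]
-/

set_option linter.dupNamespace false -- the tree's summit namespace repeats `ResolutionOfSingularities`

noncomputable section

open IsLocalRing

namespace Summit.ResolutionOfSingularities.ResolutionOfSingularities.Theorems

open Literature.AlgebraicGeometry.Resolution

/-! ## Generalities -/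

/-- Transport of regularity of `C_I` along an equality of primes `I = J`. [folklore] -/
theorem isRegularLocalRing_localization_congr {C : Type} [CommRing C] {I J : Ideal C}
    [I.IsPrime] [J.IsPrime] (h : I = J) :
    IsRegularLocalRing (Localization.AtPrime I) ↔ IsRegularLocalRing (Localization.AtPrime J) := by
  subst h
  exact Iff.rfl

/-- Transport of "`x ∈ 𝔪² ⊆ C_I`" along an equality of primes `I = J`. [folklore] -/
theorem algebraMap_mem_sq_maximalIdeal_congr {C : Type} [CommRing C] {I J : Ideal C}
    [I.IsPrime] [J.IsPrime] (h : I = J) (x : C) :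
    algebraMap C (Localization.AtPrime I) x ∈ maximalIdeal (Localization.AtPrime I) ^ 2 ↔
      algebraMap C (Localization.AtPrime J) x ∈ maximalIdeal (Localization.AtPrime J) ^ 2 := by
  subst h
  exact Iff.rfl

/-- `w f ∈ Q²` with `w ∉ Q` puts `f` into `𝔪² ⊆ C_Q` (`w` is a unit there). [folklore] -/
theorem algebraMap_mem_sq_maximalIdeal_of_mul_mem_sq {C : Type} [CommRing C] (Q : Ideal C)
    [Q.IsPrime] {w f : C} (hw : w ∉ Q) (hwf : w * f ∈ Q ^ 2) :
    algebraMap C (Localization.AtPrime Q) f ∈ maximalIdeal (Localization.AtPrime Q) ^ 2 := by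
  have hwu : IsUnit (algebraMap C (Localization.AtPrime Q) w) :=
    IsLocalization.map_units _ (⟨w, hw⟩ : Q.primeCompl)
  have h1 : algebraMap C (Localization.AtPrime Q) w * algebraMap C (Localization.AtPrime Q) f ∈
      maximalIdeal (Localization.AtPrime Q) ^ 2 := by
    rw [← map_mul, ← Localization.AtPrime.map_eq_maximalIdeal, ← Ideal.map_pow]
    exact Ideal.mem_map_of_mem _ hwf
  have := Ideal.mul_mem_left _ (hwu.unit⁻¹ : (Localization.AtPrime Q)ˣ).val h1
  rwa [← mul_assoc, IsUnit.val_inv_mul, one_mul] at this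

/-! ## The Jacobian step on a chart `R[I/xᵢ]` (every ring `R`, `x` quasi-regular) -/

section Eval

variable {R : Type} [CommRing R] {r : ℕ} (x : Fin r → R) (i : Fin r)

/-- The relations of `R[I/xᵢ]` as a quotient of `R[T_j : j ≠ i]` lie in `I · R[T]`
(Stacks 0BIQ). [cite: StacksProject, Tag 0BIQ] -/
theorem ker_eval_le_map_C (hx : IsQuasiRegular x) :
    RingHom.ker (blowupAlgebra.eval x i).toRingHom ≤
      Ideal.map MvPolynomial.C (Ideal.span (Set.range x)) := by
  intro p hp
  rw [RingHom.mem_ker] at hp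
  rw [← blowupAlgebra.eval_mem_span_algebraMap_iff' x i hx]
  change (blowupAlgebra.eval x i).toRingHom p ∈ _
  rw [hp]
  exact Ideal.zero_mem _

/-- Constants from `I` map into every prime of the chart ring containing the exceptional
equation `xᵢ` (`I · R[I/xᵢ] = (xᵢ)`). [cite: StacksProject, Tag 07Z3 (2)] -/
theorem eval_C_mem_of_mem (Q : Ideal (blowupAlgebra (Ideal.span (Set.range x)) (x i)))
    (hQi : algebraMap R (blowupAlgebra (Ideal.span (Set.range x)) (x i)) (x i) ∈ Q)
    (a : R) (ha : a ∈ Ideal.span (Set.range x)) :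
    (blowupAlgebra.eval x i).toRingHom (MvPolynomial.C a) ∈ Q := by
  change blowupAlgebra.eval x i (MvPolynomial.C a) ∈ Q
  rw [blowupAlgebra.eval_C]
  have h : algebraMap R (blowupAlgebra (Ideal.span (Set.range x)) (x i)) a ∈
      (Ideal.span (Set.range x)).map (algebraMap R (blowupAlgebra (Ideal.span (Set.range x)) (x i))) :=
    Ideal.mem_map_of_mem _ ha
  rw [map_blowupAlgebra_eq_span (blowupAlgebra.mem_span_range x i)] at h
  exact (Ideal.span_singleton_le_iff_mem _).mpr hQi h

/-- **The Jacobian step on a chart** (Stacks 07PF read contrapositively, through the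
presentation `R[T_j : j ≠ i] ↠ R[I/xᵢ]` whose relations lie in `I · R[T]`): if `Q ∋ xᵢ` is a
prime of `R[I/xᵢ]` and `w · p(x/xᵢ) ∈ Q²` for some `w ∉ Q`, then all partial derivatives
`(∂p/∂T_j)(x/xᵢ)` lie in `Q`. [cite: StacksProject, Tag 07PF] -/
theorem eval_pderiv_mem_of_mul_eval_mem_sq (hx : IsQuasiRegular x)
    (Q : Ideal (blowupAlgebra (Ideal.span (Set.range x)) (x i))) [Q.IsPrime]
    (hQi : algebraMap R (blowupAlgebra (Ideal.span (Set.range x)) (x i)) (x i) ∈ Q)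
    (p : MvPolynomial {j : Fin r // j ≠ i} R) {w : blowupAlgebra (Ideal.span (Set.range x)) (x i)}
    (hw : w ∉ Q) (hwp : w * blowupAlgebra.eval x i p ∈ Q ^ 2) (j : {j : Fin r // j ≠ i}) :
    blowupAlgebra.eval x i (MvPolynomial.pderiv j p) ∈ Q := by
  by_contra hj
  have h := notMem_sq_maximalIdeal_of_pderiv_notMem (blowupAlgebra.eval x i).toRingHom
    (blowupAlgebra.eval_surjective x i) (Ideal.span (Set.range x)) (ker_eval_le_map_C x i hx) Q
    (eval_C_mem_of_mem x i Q hQi) j p hj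
  exact h (algebraMap_mem_sq_maximalIdeal_of_mul_mem_sq Q hw hwp)

/-- **Non-divisibility by the exceptional equation, tested by a derivative**: if some iterated
partial derivative of `p` is the constant `1`, then `p(x/xᵢ) ∉ (xᵢ)` — for `(xᵢ)` pulls back to
`I · R[T]`, which is stable under `∂/∂T_j` and does not contain `1`. Here for two derivatives.
[cite: StacksProject, Tag 0BIQ] -/
theorem eval_notMem_span_of_pderiv_pderiv_eq_one (hx : IsQuasiRegular x)
    (hI : Ideal.span (Set.range x) ≠ ⊤) (p : MvPolynomial {j : Fin r // j ≠ i} R)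
    (j j' : {j : Fin r // j ≠ i})
    (hp : MvPolynomial.pderiv j' (MvPolynomial.pderiv j p) = 1) :
    blowupAlgebra.eval x i p ∉
      Ideal.span {algebraMap R (blowupAlgebra (Ideal.span (Set.range x)) (x i)) (x i)} := by
  rw [blowupAlgebra.eval_mem_span_algebraMap_iff' x i hx]
  intro h
  have h2 := MvPolynomial.pderiv_mem_map_C j' _ (MvPolynomial.pderiv_mem_map_C j _ h)
  rw [hp, MvPolynomial.mem_map_C_iff] at h2
  have h3 := h2 0
  rw [MvPolynomial.coeff_zero_one] at h3
  exact hI ((Ideal.eq_top_iff_one _).mpr h3)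

/-- The same with one derivative. [cite: StacksProject, Tag 0BIQ] -/
theorem eval_notMem_span_of_pderiv_eq_one (hx : IsQuasiRegular x)
    (hI : Ideal.span (Set.range x) ≠ ⊤) (p : MvPolynomial {j : Fin r // j ≠ i} R)
    (j : {j : Fin r // j ≠ i}) (hp : MvPolynomial.pderiv j p = 1) :
    blowupAlgebra.eval x i p ∉
      Ideal.span {algebraMap R (blowupAlgebra (Ideal.span (Set.range x)) (x i)) (x i)} := by
  rw [blowupAlgebra.eval_mem_span_algebraMap_iff' x i hx]
  intro h
  have h2 := MvPolynomial.pderiv_mem_map_C j _ h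
  rw [hp, MvPolynomial.mem_map_C_iff] at h2
  have h3 := h2 0
  rw [MvPolynomial.coeff_zero_one] at h3
  exact hI ((Ideal.eq_top_iff_one _).mpr h3)

end Eval

/-! ## Transport along a surjection with principal kernel (the hypersurface chart `R[I/a] ↠ (R/(f))[Ī/ā]`) -/

section Surjection

variable {C B : Type} [CommRing C] [CommRing B] (φ : C →+* B) (hφ : Function.Surjective φ)
  (f' : C) (hker : RingHom.ker φ = Ideal.span {f'})

include hφ hker

/-- **A singular prime of `B ≅ C/(f')` gives `w ∉ Q`, `w f' ∈ Q²`** for its preimage `Q` in the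
regular ring `C` (Stacks 07PF read contrapositively), for a surjection `φ : C ↠ B` with kernel
`(f')`. [cite: StacksProject, Tag 07PF] -/
theorem exists_mul_mem_sq_comap_of_surjective [IsRegularRing C] (𝔮 : Ideal B) [𝔮.IsPrime]
    (h𝔮 : ¬ IsRegularLocalRing (Localization.AtPrime 𝔮)) :
    ∃ w ∉ 𝔮.comap φ, w * f' ∈ 𝔮.comap φ ^ 2 := by
  let e : (C ⧸ Ideal.span {f'}) ≃+* B :=
    (Ideal.quotEquivOfEq hker.symm).trans (RingHom.quotientKerEquivOfSurjective hφ)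
  have he : ∀ x, e (Ideal.Quotient.mk _ x) = φ x := fun x => rfl
  haveI : (𝔮.comap e).IsPrime := Ideal.comap_isPrime _ _
  have hQ : (𝔮.comap e).comap (Ideal.Quotient.mk (Ideal.span {f'})) = 𝔮.comap φ := by
    ext x
    simp only [Ideal.mem_comap, he]
  rw [← hQ]
  refine exists_mul_mem_sq_of_not_isRegularLocalRing f' (𝔮.comap e) fun hreg => h𝔮 ?_
  exact IsRegularLocalRing.of_ringEquiv (IsLocalization.ringEquivOfRingEquiv
    (Localization.AtPrime (𝔮.comap e)) (Localization.AtPrime 𝔮) e (e.map_primeCompl_comap_eq 𝔮))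

omit hφ in
/-- **Primes through the kernel push forward along a surjection**: a prime `𝔯 ∋ f'` below
`φ⁻¹𝔮` maps onto a prime `φ(𝔯) ≤ 𝔮`, not containing `φ(c)` if `c ∉ 𝔯`. [folklore] -/
theorem isPrime_map_of_surjective_of_mem (hφ : Function.Surjective φ) (𝔮 : Ideal B)
    (𝔯 : Ideal C) [𝔯.IsPrime] (h𝔯 : 𝔯 ≤ 𝔮.comap φ) (hf𝔯 : f' ∈ 𝔯) {c : C} (hc : c ∉ 𝔯) :
    (𝔯.map φ).IsPrime ∧ 𝔯.map φ ≤ 𝔮 ∧ φ c ∉ 𝔯.map φ := by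
  have hker' : RingHom.ker φ ≤ 𝔯 := by
    rw [hker, Ideal.span_le, Set.singleton_subset_iff]
    exact hf𝔯
  refine ⟨Ideal.map_isPrime_of_surjective hφ hker', Ideal.map_le_iff_le_comap.mpr h𝔯, fun hmem => hc ?_⟩
  have : c ∈ (𝔯.map φ).comap φ := hmem
  rwa [Ideal.comap_map_of_surjective _ hφ, ← RingHom.ker_eq_comap_bot, sup_eq_left.mpr hker'] at this

end Surjection

/-- **Regularity of `B_𝔮 ≅ C_Q/(f')` from `f' ∉ 𝔪_Q²`** (`Q = φ⁻¹𝔮`, `C_Q` regular; Matsumura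
14.2), for a surjection `φ : C ↠ B` with kernel `(f')`. [cite: Matsumura1987, Thm. 14.2] -/
theorem isRegularLocalRing_localization_of_surjective_of_notMem_sq {C B : Type} [CommRing C] [CommRing B]
    (φ : C →+* B) (hφ : Function.Surjective φ) (f' : C) (hker : RingHom.ker φ = Ideal.span {f'})
    (𝔮 : Ideal B) [𝔮.IsPrime]
    [hreg : IsRegularLocalRing (Localization.AtPrime (𝔮.comap φ))]
    (h2 : algebraMap C (Localization.AtPrime (𝔮.comap φ)) f' ∉
      maximalIdeal (Localization.AtPrime (𝔮.comap φ)) ^ 2) :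
    IsRegularLocalRing (Localization.AtPrime 𝔮) := by
  let e : (C ⧸ Ideal.span {f'}) ≃+* B :=
    (Ideal.quotEquivOfEq hker.symm).trans (RingHom.quotientKerEquivOfSurjective hφ)
  have he : ∀ x, e (Ideal.Quotient.mk _ x) = φ x := fun x => rfl
  haveI : (𝔮.comap e).IsPrime := Ideal.comap_isPrime _ _
  have hQ : (𝔮.comap e).comap (Ideal.Quotient.mk (Ideal.span {f'})) = 𝔮.comap φ := by
    ext x
    simp only [Ideal.mem_comap, he]
  haveI : IsRegularLocalRing (Localization.AtPrime
      ((𝔮.comap e).comap (Ideal.Quotient.mk (Ideal.span {f'})))) :=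
    (isRegularLocalRing_localization_congr hQ).mpr hreg
  have hm : algebraMap C (Localization.AtPrime
      ((𝔮.comap e).comap (Ideal.Quotient.mk (Ideal.span {f'})))) f' ∈ maximalIdeal _ := by
    rw [← Localization.AtPrime.map_eq_maximalIdeal]
    exact Ideal.mem_map_of_mem _ (mem_comap_mk_span_singleton f' _)
  have hm2 : algebraMap C (Localization.AtPrime
      ((𝔮.comap e).comap (Ideal.Quotient.mk (Ideal.span {f'})))) f' ∉ maximalIdeal _ ^ 2 :=
    fun h => h2 ((algebraMap_mem_sq_maximalIdeal_congr hQ f').mp h)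
  haveI := (IsRegularLocalRing.quotient_span_singleton hm hm2).1
  haveI : IsRegularLocalRing (Localization.AtPrime (𝔮.comap e)) :=
    IsRegularLocalRing.of_ringEquiv (localizationQuotientEquiv f' (𝔮.comap e)).symm
  exact IsRegularLocalRing.of_ringEquiv (IsLocalization.ringEquivOfRingEquiv
    (Localization.AtPrime (𝔮.comap e)) (Localization.AtPrime 𝔮) e (e.map_primeCompl_comap_eq 𝔮))


/-! ## The hypersurface chart `R[I/a] ↠ (R/(f))[Ī/ā]` -/

section MapQuotient

variable {R : Type} [CommRing R] (I : Ideal R) (a f : R)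

/-- The exceptional equation pulls back: `ā ∈ 𝔮` iff `a ∈ φ⁻¹𝔮` for the chart map
`φ : R[I/a] ↠ (R/(f))[Ī/ā]`, and likewise for every `r ∈ R`. [folklore] -/
theorem algebraMap_mem_comap_mapQuotient_iff
    (𝔮 : Ideal (blowupAlgebra (I.map (Ideal.Quotient.mk (Ideal.span {f})))
      (Ideal.Quotient.mk (Ideal.span {f}) a))) (r : R) :
    algebraMap R (blowupAlgebra I a) r ∈ 𝔮.comap (blowupAlgebra.mapQuotient I a (Ideal.span {f})) ↔
      algebraMap (R ⧸ Ideal.span {f}) _ (Ideal.Quotient.mk (Ideal.span {f}) r) ∈ 𝔮 := by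
  rw [Ideal.mem_comap, blowupAlgebra.mapQuotient_algebraMap]

/-- Extended ideals push forward along the chart map: `φ(K R[I/a]) = K̄ (R/(f))[Ī/ā]`.
[folklore] -/
theorem map_mapQuotient_map_algebraMap (K : Ideal R) :
    (K.map (algebraMap R (blowupAlgebra I a))).map (blowupAlgebra.mapQuotient I a (Ideal.span {f})) =
      (K.map (Ideal.Quotient.mk (Ideal.span {f}))).map
        (algebraMap (R ⧸ Ideal.span {f}) (blowupAlgebra (I.map (Ideal.Quotient.mk (Ideal.span {f})))
          (Ideal.Quotient.mk (Ideal.span {f}) a))) := by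
  -- adapted from `exists_prime_le_of_not_isRegularLocalRing` (NodalBlowupAffineCharts.lean)
  have hcomp : (blowupAlgebra.mapQuotient I a (Ideal.span {f})).comp
      (algebraMap R (blowupAlgebra I a)) =
      (algebraMap (R ⧸ Ideal.span {f}) (blowupAlgebra (I.map (Ideal.Quotient.mk (Ideal.span {f})))
        (Ideal.Quotient.mk (Ideal.span {f}) a))).comp (Ideal.Quotient.mk (Ideal.span {f})) :=
    RingHom.ext fun r => blowupAlgebra.mapQuotient_algebraMap _ _ _ r
  rw [Ideal.map_map, hcomp, ← Ideal.map_map]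

end MapQuotient

end Summit.ResolutionOfSingularities.ResolutionOfSingularities.Theorems

end
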